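import Mathlib

/-!
# `SnSubsetDichotomy.PolynomialSlack`, line `transport-split-hull` — stub `sharp_excess_explicit`

Crux `Summit.MatrixMultiplication.MatrixMultiplication.Theses.SnSubsetDichotomy.PolynomialSlack`
(item `stmt-MatrixMultiplication-8306`), level-one programme, lead c8 (one dense quotient: the
F-explicit sharp heavy-mass excess).  Registered stub `sharp_excess_explicit` of
`Cruxes/PolynomialSlack/Lines/transport-split-hull.lean`; pure real arithmetic.

With `α = |S||T|`, `β = |T||U|`, `γ = |U||S|` the sizes of the three quotient pairs of a TPP triple
in `S_n`, `K_A = n!/α`, `K_B = n!/β`, `K_C = n!/γ` their co-densities, `K_A K_B K_C = F²` and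
`K_A < 16 M` (the dense quotient), one has `F² = K_A (K_B K_C) < 16 M (K_B K_C)`, so the larger
`K` of `K_B, K_C` satisfies `K² ≥ K_B K_C ≥ F²/(16 M)`, i.e. `F ≤ 4 √M K`.  For a pair of size `ζ`
with co-density `K = n!/ζ` the excess `(Λ/(n!/(ζ n M)))² (n-2)!/ζ` equals `Λ² n M²/((n-1) K)`
(as `n! = n (n-1) (n-2)!`), which is therefore at most `4 Λ² n M² √M/((n-1) F)`.
-/

namespace Summit.MatrixMultiplication.MatrixMultiplication.Theorems.PolynomialSlack

-- `Summit.<Summit>.<Problem>` is the tree's mandated summit-side namespace; for this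
-- single-conjunct summit the two coincide, so the file silences `dupNamespace`.
set_option linter.dupNamespace false

/-- `n! = n (n-1) (n-2)!` over `ℝ`, for `n ≥ 2`. [folklore] -/
theorem sharpExcess_factorial_eq {n : ℕ} (hn : 2 ≤ n) :
    (n.factorial : ℝ) = n * ((n : ℝ) - 1) * ((n - 2).factorial : ℝ) := by
  have h2 : n = (n - 2) + 2 := by omega
  conv_lhs => rw [h2]
  rw [Nat.factorial_succ, Nat.factorial_succ]
  push_cast
  have : (((n - 2 : ℕ) : ℝ)) = (n : ℝ) - 2 := by rw [Nat.cast_sub (by omega)]; norm_num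
  rw [this]; ring

/-- The excess of a quotient pair of size `ζ` with co-density `K = n!/ζ`:
`(Λ/(n!/(ζ n M)))² (n-2)!/ζ = Λ² n M²/((n-1) K)` (`n ≥ 2`, `M, ζ > 0`). [folklore] -/
theorem sharpExcess_excess_eq {n : ℕ} (hn : 2 ≤ n) (Λ M ζ : ℝ) (hM : 0 < M) (hζ : 0 < ζ) :
    (Λ / ((n.factorial : ℝ) / (ζ * n * M))) ^ 2 * (n - 2).factorial / ζ =
      Λ ^ 2 * n * M ^ 2 / (((n : ℝ) - 1) * ((n.factorial : ℝ) / ζ)) := by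
  have hn0 : (0 : ℝ) < n := by exact_mod_cast (show 0 < n by omega)
  have hm0 : (0 : ℝ) < (n : ℝ) - 1 := by
    have : (2 : ℝ) ≤ n := by exact_mod_cast hn
    linarith
  have hf0 : (0 : ℝ) < ((n - 2).factorial : ℝ) := by exact_mod_cast Nat.factorial_pos _
  rw [sharpExcess_factorial_eq hn]
  field_simp

/-- Square roots: `F² ≤ K² (4² M)` with `F, K ≥ 0` gives `F ≤ K (4 √M)`. [folklore] -/
theorem sharpExcess_le_of_sq_le {F K M : ℝ} (hF : 0 ≤ F) (hK : 0 ≤ K)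
    (h : F ^ 2 ≤ K ^ 2 * (4 ^ 2 * M)) : F ≤ K * (4 * Real.sqrt M) := by
  calc F = Real.sqrt (F ^ 2) := (Real.sqrt_sq hF).symm
    _ ≤ Real.sqrt (K ^ 2 * (4 ^ 2 * M)) := Real.sqrt_le_sqrt h
    _ = K * (4 * Real.sqrt M) := by
        rw [Real.sqrt_mul (sq_nonneg K), Real.sqrt_sq hK, Real.sqrt_mul (by norm_num),
          Real.sqrt_sq (by norm_num)]

/-- **The F-explicit sharp heavy-mass excess (one dense quotient).** With `K_A = n!/α`, `K_B = n!/β`,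
`K_C = n!/γ`, `K_A K_B K_C = F²` and `K_A < 16 M`, the larger `K` of `K_B, K_C` has `K ≥ F/(4√M)`, and
the excess `(Λ/(n!/(ζ n M)))² (n-2)!/ζ = Λ² n M²/((n-1) K)` of the corresponding pair (`ζ = β` or
`ζ = γ`) is at most `4 Λ² n M² √M/((n-1) F)`. [folklore] -/
theorem sharp_excess_explicit {n : ℕ} (hn : 2 ≤ n) (Λ M F α β γ : ℝ) (hΛ : 0 < Λ) (hM : 1 ≤ M)
    (hF : 0 < F) (hα : 0 < α) (hβ : 0 < β) (hγ : 0 < γ)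
    (hKKK : (n.factorial : ℝ) / α * ((n.factorial : ℝ) / β) * ((n.factorial : ℝ) / γ) = F ^ 2)
    (hKA : (n.factorial : ℝ) / α < 16 * M) :
    (Λ / ((n.factorial : ℝ) / (β * n * M))) ^ 2 * (n - 2).factorial / β ≤
        4 * Λ ^ 2 * n * M ^ 2 * Real.sqrt M / (((n : ℝ) - 1) * F) ∨
      (Λ / ((n.factorial : ℝ) / (γ * n * M))) ^ 2 * (n - 2).factorial / γ ≤
        4 * Λ ^ 2 * n * M ^ 2 * Real.sqrt M / (((n : ℝ) - 1) * F) := by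
  have _ := hΛ
  have hM0 : 0 < M := by linarith
  have hn0 : (0 : ℝ) < n := by exact_mod_cast (show 0 < n by omega)
  have hm0 : (0 : ℝ) < (n : ℝ) - 1 := by
    have : (2 : ℝ) ≤ n := by exact_mod_cast hn
    linarith
  have hf0 : (0 : ℝ) < (n.factorial : ℝ) := by exact_mod_cast Nat.factorial_pos _
  have hsM0 : 0 < Real.sqrt M := Real.sqrt_pos.2 hM0
  -- the co-densities
  obtain ⟨KA, hKAdef⟩ : ∃ K : ℝ, K = (n.factorial : ℝ) / α := ⟨_, rfl⟩
  obtain ⟨KB, hKBdef⟩ : ∃ K : ℝ, K = (n.factorial : ℝ) / β := ⟨_, rfl⟩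
  obtain ⟨KC, hKCdef⟩ : ∃ K : ℝ, K = (n.factorial : ℝ) / γ := ⟨_, rfl⟩
  rw [← hKAdef, ← hKBdef, ← hKCdef] at hKKK
  rw [← hKAdef] at hKA
  have hKA0 : 0 < KA := by rw [hKAdef]; positivity
  have hKB0 : 0 < KB := by rw [hKBdef]; positivity
  have hKC0 : 0 < KC := by rw [hKCdef]; positivity
  -- `K_B K_C > F²/(16 M)`: `F² = K_A (K_B K_C) < 16 M (K_B K_C)`
  have hKBC : F ^ 2 ≤ 16 * M * (KB * KC) := by
    have h1 : KA * (KB * KC) = F ^ 2 := by rw [← hKKK]; ring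
    have h2 : F ^ 2 < 16 * M * (KB * KC) := by
      rw [← h1]; exact mul_lt_mul_of_pos_right hKA (mul_pos hKB0 hKC0)
    exact h2.le
  -- the larger of `K_B, K_C` is at least `F/(4√M)`
  have hKZ : ∀ K : ℝ, KB * KC ≤ K ^ 2 → 0 < K → F ≤ K * (4 * Real.sqrt M) := by
    intro K hK hK0
    refine sharpExcess_le_of_sq_le hF.le hK0.le ?_
    nlinarith
  -- the bound for a quotient whose co-density `K` has `F ≤ 4√M K`
  have hbound : ∀ K : ℝ, F ≤ K * (4 * Real.sqrt M) → 0 < K →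
      Λ ^ 2 * n * M ^ 2 / (((n : ℝ) - 1) * K) ≤
        4 * Λ ^ 2 * n * M ^ 2 * Real.sqrt M / (((n : ℝ) - 1) * F) := by
    intro K hK hK0
    rw [div_le_div_iff₀ (by positivity) (by positivity)]
    have h2 : 0 ≤ Λ ^ 2 * n * M ^ 2 * ((n : ℝ) - 1) := by positivity
    have h3 := mul_le_mul_of_nonneg_left hK h2
    linarith [h3]
  rcases le_or_gt KB KC with h | h
  · right
    rw [sharpExcess_excess_eq hn Λ M γ hM0 hγ, ← hKCdef]
    have hK : KB * KC ≤ KC ^ 2 := by nlinarith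
    exact hbound KC (hKZ KC hK hKC0) hKC0
  · left
    rw [sharpExcess_excess_eq hn Λ M β hM0 hβ, ← hKBdef]
    have hK : KB * KC ≤ KB ^ 2 := by nlinarith
    exact hbound KB (hKZ KB hK hKB0) hKB0

end Summit.MatrixMultiplication.MatrixMultiplication.Theorems.PolynomialSlack
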